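import Summits.Ventures.PercRepro.SixFourResidueFourGenericAll

/-!
# PercRepro — C-025 at `(6,4)`: the plane-line branch (γ) at `t = 4`, part 0 — the quantitative per-plane bound
and the non-generic accounting (p5, gen 10; lead (nn))

The `t = 4` twin of p2's `SixFourResidueThreePlaneLineCore.lean`.  For a plane-line solid (mine-2's §21.17 (c) /
§21.18.7: `G = ρ ∪ λ` with `ρ` a plane trace of `p ≤ g − 3` points and `λ` of rank `≤ 2`) every plane trace has
`≤ g − 3` points, so the additive certificate of `SixFourResidueFourGenericAll.lean` applies to every rank-`3`
plane, but the partner count `X` is no longer bounded by the crude `Σ_P Ξ_g(|P ∩ G| − 1)` of the generic case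
(`Xcnt_le_sum_xiCrude` needs `Generic M G`).  The branch therefore works with

* **`slack4 M G P`** `:= certRHS4 − cost − (2/3)·lppCredit`, the (★)-free per-plane slack of mine-2's
  `slack_g(P)`; on a rank-`3` trace it is the additive line sum `Σ_λ L(g,p,m_λ) − base(g,p)`
  (`slack4_eq_sum_Lterm4`, the identity inside `cert_plane_of_perPair4`);
* **`slack4_ge_of_mu`** — the QUANTITATIVE per-plane bound: for any `μ` with `μ·C(m,2) ≤ L(g,p,m)` on every line
  size `2 ≤ m < p`, `slack4(P) ≥ C(p,2)·μ − base(g,p)`; with `μ = min_m L(g,p,m)/C(m,2)` this is mine-2's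
  `T⁺(g,p) = C(p,2)·min_m L(m)/C(m,2) − base(p)` (§21.13.3 / §21.18.7), the credit of the big plane and of each
  plane through the outside line;
* **`J_four_ge_sum_slack_sub`** — the accounting `J₄ ≥ Σ_{P : r(P ∩ G) = 3} slack4(P) − (6/5)·X` for EVERY rank-`4`
  set with `g ≥ 7` (the non-generic form of `J_four_nonneg_of_generic_of_perPair`: the same assembly without the
  partner bound F8), i.e. §21.18.7's `Jlow′(π) = Σ_{P ∈ 𝒫(π)} slack_g(P) − (6/5)·X̄′(π)` read with `X̄′ := X`.

What the branch still needs (not here): Lemma X̄′ (§21.18.4 (a): `X ≤ 2[Σ_j 2^{s_j} + 2^{n+e}·[covering pair] +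
4n·#classes]` on a plane-line solid), the plane inventory of a plane-line solid (the big plane `ρ`, the
`n + s_j`-point planes through `ℓ′`, the rest), Lemma TW (the termwise rearrangement), the tables TW-100
(`13 ≤ g ≤ 100`) and the lists (`g ≤ 12`), and the tail TW-∞ (`g ≥ 101`, mine-2's `perPair4_margin` draft).
-/

namespace PercRepro.SixFour

open Finset ThmH

variable {α : Type*} [DecidableEq α] {M : Matroid α} [M.Finite] {G : Finset α}

/-- **The per-plane slack at `t = 4`**: `slack4(P) = certRHS4(P) − cost(P) − (2/3)·lppCredit(P)` — mine-2's
`slack_g(P)` (§21.13.1) in the tree's vocabulary. -/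
noncomputable def slack4 (M : Matroid α) [M.Finite] (G P : Finset α) : ℚ :=
  certRHS4 M G P G.card - cost M G P - 2 / 3 * (lppCredit M G P : ℚ)

/-- **The per-plane slack is the additive line sum**: on a rank-`3` plane trace `ρ` with `p` points,
`slack4(P) = Σ_λ L(g,p,m_λ) − base(g,p)` (the identity inside `cert_plane_of_perPair4`). -/
theorem slack4_eq_sum_Lterm4 (hs : Simple M) (hG : G ⊆ gr M) {P : Finset α}
    (hr : M.eRk ((P ∩ G : Finset α) : Set α) = 3) :
    slack4 M G P = ∑ L ∈ lines M, Lterm4 G.card (P ∩ G).card (L ∩ (P ∩ G)).card - base4 G.card (P ∩ G).card := by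
  set ρ := P ∩ G with hρdef
  have hρ : ρ ⊆ gr M := Finset.inter_subset_right.trans hG
  -- the identities for `D₃`, `r₃₄`, `lppCredit` in line-sum form
  have hD : (D3 M G P : ℚ) = (delta ρ.card : ℚ) - ∑ L ∈ lines M, (delta (L ∩ ρ).card : ℚ) := by
    have h := D3_add_sum_delta hs hρ hr
    have h' : (D3 M G P : ℚ) + ∑ L ∈ lines M, (delta (L ∩ ρ).card : ℚ) = (delta ρ.card : ℚ) := by
      unfold D3
      exact_mod_cast h
    linarith
  have hR : (r34 M G P : ℚ) = (ρ.card.choose 4 : ℚ) - ∑ L ∈ lines M, ((L ∩ ρ).card.choose 4 : ℚ) := by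
    have h := r34_add_sum_choose_four_lines hs hG hr
    have h' : (r34 M G P : ℚ) + ∑ L ∈ lines M, ((L ∩ ρ).card.choose 4 : ℚ) = (ρ.card.choose 4 : ℚ) := by
      exact_mod_cast h
    linarith
  have hL : (lppCredit M G P : ℚ) =
      ∑ L ∈ lines M, ((eps (L ∩ ρ).card : ℚ) * ((ρ.card - (L ∩ ρ).card).choose 2 : ℚ)) := by
    unfold lppCredit
    push_cast
    rfl
  have hsplit : ∑ L ∈ lines M, Lterm4 G.card ρ.card (L ∩ ρ).card =
      ∑ L ∈ lines M, yPrice4 G.card (L ∩ ρ).card * ((ρ.card - (L ∩ ρ).card : ℕ) : ℚ) +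
        ((G.card : ℚ) - ρ.card - 2 / 5) * ∑ L ∈ lines M, (delta (L ∩ ρ).card : ℚ) -
        8 / 5 * ∑ L ∈ lines M, ((L ∩ ρ).card.choose 4 : ℚ) -
        2 / 3 * ∑ L ∈ lines M, ((eps (L ∩ ρ).card : ℚ) * ((ρ.card - (L ∩ ρ).card).choose 2 : ℚ)) := by
    simp only [Lterm4, Finset.sum_add_distrib, Finset.sum_sub_distrib, Finset.mul_sum]
  unfold slack4 certRHS4 cost base4
  rw [← hρdef, hsplit, hD, hR, hL]
  ring

/-- **The quantitative per-plane bound at `t = 4`**: if `μ·C(m,2) ≤ L(g,p,m)` for every line size `2 ≤ m < p`,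
then `slack4(P) ≥ C(p,2)·μ − base(g,p)` on a rank-`3` plane trace with `p` points (§21.13.3: with
`μ = min_m L(g,p,m)/C(m,2)` the right side is mine-2's `T⁺(g,p)`). -/
theorem slack4_ge_of_mu (hs : Simple M) (hG : G ⊆ gr M) {P : Finset α}
    (hr : M.eRk ((P ∩ G : Finset α) : Set α) = 3) (μ : ℚ)
    (hpp : ∀ m, 2 ≤ m → m < (P ∩ G).card → μ * (m.choose 2 : ℚ) ≤ Lterm4 G.card (P ∩ G).card m) :
    ((P ∩ G).card.choose 2 : ℚ) * μ - base4 G.card (P ∩ G).card ≤ slack4 M G P := by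
  rw [slack4_eq_sum_Lterm4 hs hG hr]
  set ρ := P ∩ G with hρdef
  have hρ : ρ ⊆ gr M := Finset.inter_subset_right.trans hG
  -- the line sizes are `< p` (a line containing the whole trace would have rank `2`)
  have hlt : ∀ L ∈ lines M, (L ∩ ρ).card < ρ.card := by
    intro L hL
    have hle : (L ∩ ρ).card ≤ ρ.card := Finset.card_le_card Finset.inter_subset_right
    rcases Nat.lt_or_ge (L ∩ ρ).card ρ.card with h | h
    · exact h
    · exfalso
      have heq : L ∩ ρ = ρ := Finset.eq_of_subset_of_card_le Finset.inter_subset_right h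
      have hsub : ρ ⊆ L := by rw [← heq]; exact Finset.inter_subset_left
      have h2 := M.eRk_mono (Finset.coe_subset.2 hsub)
      rw [hr, (mem_lines.1 hL).2.2] at h2
      have h32 : (3 : ℕ) ≤ 2 := by exact_mod_cast h2
      omega
  have hterm : ∀ L ∈ lines M, μ * ((L ∩ ρ).card.choose 2 : ℚ) ≤ Lterm4 G.card ρ.card (L ∩ ρ).card := by
    intro L hL
    rcases Nat.lt_or_ge (L ∩ ρ).card 2 with h | h
    · rw [Lterm4_eq_zero_of_le_one _ _ (by omega)]
      interval_cases hm : (L ∩ ρ).card <;> simp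
    · exact hpp _ h (hlt L hL)
  have hsum := Finset.sum_le_sum hterm
  have hpairs : ∑ L ∈ lines M, ((L ∩ ρ).card.choose 2 : ℚ) = (ρ.card.choose 2 : ℚ) := by
    exact_mod_cast sum_choose_two_trace hs hρ
  rw [← Finset.mul_sum, hpairs] at hsum
  linarith

/-- **`J₄ ≥ Σ_{P : r(P ∩ G) = 3} slack4(P) − (6/5)·X`** for every rank-`4` set with `g ≥ 7` — the accounting of
`J_four_nonneg_of_generic_of_perPair` without genericity (the partner count `X` kept as is). -/
theorem J_four_ge_sum_slack_sub (hs : Simple M) (hG : G ⊆ gr M) (hr : M.eRk (G : Set α) = 4) (hg : 7 ≤ G.card) :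
    ∑ P ∈ (planes M).filter (fun P : Finset α => M.eRk ((P ∩ G : Finset α) : Set α) = 3), slack4 M G P -
      6 / 5 * (Xcnt M G : ℚ) ≤ J M G 4 := by
  set S := (planes M).filter (fun P : Finset α => M.eRk ((P ∩ G : Finset α) : Set α) = 3) with hS
  -- F1: the identity
  have F1 := J_four_identity hs hG hr
  -- F2: the cost sum restricted to the rank-`3` planes
  have F2 := sum_cost_le (M := M) G
  -- F4: the right side over `S` is the right side over all planes (it vanishes elsewhere)
  have F4 : ∑ P ∈ S, certRHS4 M G P G.card = ∑ P ∈ planes M, certRHS4 M G P G.card := by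
    rw [hS]
    apply Finset.sum_subset (Finset.filter_subset _ _)
    intro P hP hPS
    rw [Finset.mem_filter, not_and] at hPS
    exact certRHS4_eq_zero_of_ne hs hG hP (hPS hP)
  -- F5 + F6: the right side as the line quantities, with the price identities
  have F56 : ∑ P ∈ planes M, certRHS4 M G P G.card =
      yP4 G.card * ∑ L ∈ lines M, ((L ∩ G).card.choose 2 : ℚ) + ∑ L ∈ lines M, bonus (L ∩ G).card +
        2 / 3 * ∑ L ∈ lines M, ((eps (L ∩ G).card : ℚ) * ((G.card - (L ∩ G).card).choose 2 : ℚ)) := by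
    rw [sum_certRHS4_eq hs hG]
    rw [sum_lines_eq_sum_inc_rat G (fun m => (m.choose 2 : ℚ)), sum_lines_eq_sum_inc_rat G (fun m => bonus m),
      sum_lines_eq_sum_inc_rat G (fun m => (eps m : ℚ) * ((G.card - m).choose 2 : ℚ))]
    rw [Finset.mul_sum, Finset.mul_sum, ← Finset.sum_add_distrib, ← Finset.sum_add_distrib]
    refine Finset.sum_congr rfl (fun m hm => ?_)
    rw [Finset.mem_range] at hm
    rcases Nat.lt_or_ge m G.card with hlt | hge
    · rw [price_identity4 hlt]
      unfold bLines
      ring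
    · have hm' : m = G.card := by omega
      subst hm'
      rw [show bLines M G G.card = inc M G G.card from rfl, ← show bLines M G G.card = inc M G G.card from rfl,
        bLines_self_eq_zero hr]
      simp
  -- F7: `Σ_λ C(m_λ,2) = C(g,2)`
  have F7 : ∑ L ∈ lines M, ((L ∩ G).card.choose 2 : ℚ) = (G.card.choose 2 : ℚ) := by
    exact_mod_cast sum_choose_two_trace hs hG
  -- F9: the `lpp` lower bound
  have F9 : ∑ L ∈ lines M, ((eps (L ∩ G).card : ℚ) * ((crossPairs M G L).card : ℚ)) ≤ (lpp M G : ℚ) := by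
    have := lpp_ge hs hG
    have h' : ∑ L ∈ lines M, ((eps (L ∩ G).card : ℚ) * ((crossPairs M G L).card : ℚ)) =
        ((∑ L ∈ lines M, eps (L ∩ G).card * (crossPairs M G L).card : ℕ) : ℚ) := by push_cast; rfl
    rw [h']
    exact_mod_cast this
  -- F10: the lpp credit
  have F10 : ∑ L ∈ lines M, ((eps (L ∩ G).card : ℚ) * ((G.card - (L ∩ G).card).choose 2 : ℚ)) ≤
      ∑ L ∈ lines M, ((eps (L ∩ G).card : ℚ) * ((crossPairs M G L).card : ℚ)) + ∑ P ∈ S, (lppCredit M G P : ℚ) := by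
    have := sum_eps_choose_le hs hG
    rw [← hS] at this
    have h1 : ∑ L ∈ lines M, ((eps (L ∩ G).card : ℚ) * ((G.card - (L ∩ G).card).choose 2 : ℚ)) =
        ((∑ L ∈ lines M, eps (L ∩ G).card * (G.card - (L ∩ G).card).choose 2 : ℕ) : ℚ) := by push_cast; rfl
    have h2 : ∑ L ∈ lines M, ((eps (L ∩ G).card : ℚ) * ((crossPairs M G L).card : ℚ)) =
        ((∑ L ∈ lines M, eps (L ∩ G).card * (crossPairs M G L).card : ℕ) : ℚ) := by push_cast; rfl
    have h3 : ∑ P ∈ S, (lppCredit M G P : ℚ) = ((∑ P ∈ S, lppCredit M G P : ℕ) : ℚ) := by push_cast; rfl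
    rw [h1, h2, h3, ← Nat.cast_add]
    exact_mod_cast this
  -- F11: `F(g) = y_P·C(g,2)`
  have F11 := Fg_eq_yP4 (g := G.card) (by omega)
  have hslack : ∑ P ∈ S, slack4 M G P =
      ∑ P ∈ S, certRHS4 M G P G.card - ∑ P ∈ S, cost M G P - 2 / 3 * ∑ P ∈ S, (lppCredit M G P : ℚ) := by
    unfold slack4
    rw [Finset.sum_sub_distrib, Finset.sum_sub_distrib, Finset.mul_sum]
  rw [hslack, F1]
  rw [F7] at F56
  linarith [F2, F4, F56, F9, F10, F11]

end PercRepro.SixFour
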